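import Literature.NumberTheory.Automorphic.DiscreteAutomorphicRepArchModuleCM
import Literature.NumberTheory.Automorphic.UnitaryGroupArchSection
import HarnessLib

/-!
# FLOOR-0 P3 — rung-1 brick (F-1): the CM THREE-FACTOR structure `U(H)(𝔸_{L⁺}) = U(2,1) · K_c · U(H)(𝔸_{L⁺,f})` at a GENERAL
# frame `(L, ι, H, T, hT)` — exactly the binders `hcomm₁ hcomm₂ hcomm₃ hgen` of the letter F1b (★ `UnitaryEquivOfComponents`) and the
# commuting-factor hypothesis of F1a ∕ F2, at `(cmArchSection, cmCompactFactor)` and at `(cmArchSectionUForm, cmCompactFactor)`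

Cell hodgecm-mathlib, FLOOR 0, crux item H413 = stmt-HodgeConjecture-24833, line `Cruxes/H413/Lines/F0_U3CohMultOne.lean` v1.4;
integrator map `F0/P3/ENGINE-INTERFACES.F0P3g0.md` §7 ∕ typ3 memo `F0/P3/typ3/TYPED-D4F1F2.v1` («CM `hfac`∕`hgen` discharge recipe — ONE
prover brick»).  PROOF lane (no `def`, no named fact, no `sorry`); author F0P3-p04 (g3).

WHAT.  For a CM field `L`, `ι : L →+* ℂ`, `H ∈ M₃(L)` with a frame `T` (`Tᴴ ι(H) T = diag(1,1,−1)`), the three subgroups of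
`𝒰 := U(H)(𝔸_{L⁺}) = (adelicGroupData L⁺ L c̄ 3 H).Adelic`
* the archimedean factor AT `ι`: the image of ★ `cmArchSection L ι H T hT : U21 →* 𝒰` (= ★ `archSectionU21CM`),
* the archimedean factor AWAY from `ι`: ★ `cmCompactFactor L ι H T hT = (ker archProjU21EmbCM).map archToAdelic ≅ ∏_{w ≠ w(ι)} U(H^{σ_w})`,
* the finite-adelic points ★ `finAdelicToAdelic L⁺ L c̄ 3 H : U(H)(𝔸_{L⁺,f}) →* 𝒰`,
PAIRWISE COMMUTE and GENERATE: every `x ∈ 𝒰` is `cmArchSection u · k · (1, g)` (§1 `cm_threeFactor`); `cmCompactFactor` is compact when `H` is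
definite at the places `≠ ι` (★ `isCompact_cmCompactFactor`, not repeated).  §2 restates the four clauses for the `U(2,1)_{Fin 2 ⊕ Fin 1}`-framed
section ★ `cmArchSectionUForm L ι H T hT = cmArchSection ∘ u21FrameEquivFin1⁻¹` (D4's CM companion), i.e. EXACTLY the binders `hcomm₁`,
`hcomm₂`, `hcomm₃`, `hgen` of ★ `DiscreteAutomorphicRep.UnitaryEquivOfComponents P P′ (uFormGroup (Fin 2) (Fin 1)) (cmArchSectionUForm …)
(cmCompactFactor …)` (letter F1b).  (The two-factor commuting hypothesis `hfac` of F1a ∕ F2 — `∃ C` centralising the section with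
`U(H)(𝔸) = section · C` — is F0P3-p03 (g3)'s ★ `F0P3ArchIsotypyCM` ∕ F0P3-p02 (g3)'s `F0P3HolProjectionOfF2` §3; it follows from §1 with
`C := cmCompactFactor ⊔ range finAdelicToAdelic` and is not repeated here.)

PROOF = the argument of ★ `P4StubT1ArchFactor.archFactorOf_isHonest` (which is this statement at HodgeCM's Sylvester frame only) at a
general frame: ★ `commute_archSectionU21CM_of_mem_awayFromCM` (with `K_c ≤ awayFrom` via ★ `archToAdelic_mem_awayFrom_iff` + ★
`ker_archProjU21Emb`, and with the finite-adelic points via ★ `finAdelicToAdelic_mem_awayFrom`), ★ `commute_archToAdelic_finAdelicToAdelic`,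
and the decomposition `x = (x_∞, 1)(1, x_f)` (★ `archToAdelic_mul_finAdelicToAdelic`) with `x_∞ = archSingle((x_∞)_ι) · a′`, `a′ ∈ ker`
(★ `archSectionU21Emb_apply`, `archLocalOfEmb_archAtEmb`, `archAt_archSingle_self`).

References: A. Borel, H. Jacquet, *Automorphic forms and automorphic representations*, PSPM 33.1 (1979), §4.1 [BorelJacquet1979];
V. Platonov, A. Rapinchuk, *Algebraic groups and number theory* (1994), §5.1 [PlatonovRapinchuk1994].
HONEST LABEL: HC_CM is proved only modulo the printed citations until rung 0 closes; this file discharges none of them.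
-/

set_option autoImplicit false
set_option linter.dupNamespace false

noncomputable section

namespace Summit.HodgeConjecture.HodgeConjecture.Cruxes.H413.F0P3CMThreeFactor

open scoped Matrix
open NumberField NumberField.InfinitePlace
open Literature.NumberTheory.Automorphic Literature.NumberTheory.Automorphic.UnitaryGroup
open Literature.NumberTheory.Automorphic.UnitaryGroup.CotangentForms (cmArchSection cmCompactFactor)
open Literature.Geometry.ComplexHyperbolic.BallModel (U21)
open Literature.RepresentationTheory.KonnoKonno2007 Literature.RepresentationTheory.KonnoKonno2007.RealDualPair

variable (L : Type) [Field L] [NumberField L] [IsCMField L] (ι : L →+* ℂ) (H : Matrix (Fin 3) (Fin 3) L) (T : GL (Fin 3) ℂ)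
  (hT : (T : Matrix (Fin 3) (Fin 3) ℂ)ᴴ * H.map ι * (T : Matrix (Fin 3) (Fin 3) ℂ) = Literature.Geometry.ComplexHyperbolic.BallModel.J)

/-! ## §1 The three factors at `(cmArchSection, cmCompactFactor, finAdelicToAdelic)` -/

/-- **The CM three-factor structure at a general frame**: `cmArchSection(U(2,1))`, `cmCompactFactor` and `U(H)(𝔸_{L⁺,f})` pairwise
commute in `U(H)(𝔸_{L⁺})` and every adelic point factors as `cmArchSection u · k · (1, g)` with `k ∈ cmCompactFactor`.
[cite: BorelJacquet1979, §4.1] [cite: PlatonovRapinchuk1994, §5.1] -/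
theorem cm_threeFactor :
    (∀ (u : U21) (k : (adelicGroupData (↥(maximalRealSubfield L)) L (IsCMField.complexConj L) 3 H).Adelic),
        k ∈ cmCompactFactor L ι H T hT → cmArchSection L ι H T hT u * k = k * cmArchSection L ι H T hT u) ∧
    (∀ (u : U21) (g : finAdelic (↥(maximalRealSubfield L)) L (IsCMField.complexConj L) 3 H),
        cmArchSection L ι H T hT u * finAdelicToAdelic (↥(maximalRealSubfield L)) L (IsCMField.complexConj L) 3 H g =
          finAdelicToAdelic (↥(maximalRealSubfield L)) L (IsCMField.complexConj L) 3 H g * cmArchSection L ι H T hT u) ∧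
    (∀ k : (adelicGroupData (↥(maximalRealSubfield L)) L (IsCMField.complexConj L) 3 H).Adelic, k ∈ cmCompactFactor L ι H T hT →
        ∀ g : finAdelic (↥(maximalRealSubfield L)) L (IsCMField.complexConj L) 3 H,
          k * finAdelicToAdelic (↥(maximalRealSubfield L)) L (IsCMField.complexConj L) 3 H g =
            finAdelicToAdelic (↥(maximalRealSubfield L)) L (IsCMField.complexConj L) 3 H g * k) ∧
    (∀ x : (adelicGroupData (↥(maximalRealSubfield L)) L (IsCMField.complexConj L) 3 H).Adelic,
        ∃ (u : U21) (k : (adelicGroupData (↥(maximalRealSubfield L)) L (IsCMField.complexConj L) 3 H).Adelic)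
          (g : finAdelic (↥(maximalRealSubfield L)) L (IsCMField.complexConj L) 3 H),
          k ∈ cmCompactFactor L ι H T hT ∧
            x = cmArchSection L ι H T hT u * k * finAdelicToAdelic (↥(maximalRealSubfield L)) L (IsCMField.complexConj L) 3 H g) := by
  -- notation (as in ★ `archFactorOf_isHonest`, at a general frame)
  let Fp : Type := ↥(maximalRealSubfield L)
  let c := IsCMField.complexConj L
  have hc : c ≠ 1 := IsCMField.complexConj_ne_one L
  have hfix : ∀ w : InfinitePlace L, c • w = w := UnitaryGroup.complexConj_smul_infinitePlace L
  have hι : IsComplex (InfinitePlace.mk ι) := isComplex_mk_of_isCMField L ι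
  have hT' : formCongr (starRingEnd ℂ) T (H.map ι) = Literature.Geometry.ComplexHyperbolic.BallModel.J :=
    formCongr_eq_of_conjTranspose L ι H T hT
  let w₁ : {w : InfinitePlace L // IsComplex w} := placeOf L ι hι
  let ιinf : U21 →* (adelicGroupData Fp L c 3 H).Adelic := archSectionU21Emb Fp L c hc hfix ι hι H T hT'
  let proj : arch Fp L c 3 H →* U21 := archProjU21Emb Fp L c H ι hι T hT' (hfix _) hc
  let toA : arch Fp L c 3 H →* (adelicGroupData Fp L c 3 H).Adelic := archToAdelic Fp L c 3 H
  let toF : finAdelic Fp L c 3 H →* (adelicGroupData Fp L c 3 H).Adelic := finAdelicToAdelic Fp L c 3 H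
  have hιinf : cmArchSection L ι H T hT = ιinf := rfl
  have hKc : cmCompactFactor L ι H T hT = proj.ker.map toA := rfl
  -- (a) `ιinf (proj a) = archToAdelic (archSingle w₁ (archAt w₁ a))`
  have key : ∀ a : arch Fp L c 3 H,
      ιinf (proj a) = toA (archSingle Fp L c 3 H hc hfix w₁ (archAt Fp L c 3 H w₁ (hfix w₁.1) hc a)) := by
    intro a
    show archSectionU21Emb Fp L c hc hfix ι hι H T hT' (archProjU21Emb Fp L c H ι hι T hT' (hfix _) hc a) = _
    rw [archSectionU21Emb_apply, adelicSingle_apply]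
    congr 2
    show archLocalOfEmb L 3 H ι hι ((formEquivU21 L H ι T hT').symm
      ((formEquivU21 L H ι T hT') (archAtEmb Fp L c 3 H ι hι (hfix _) hc a))) = _
    rw [ContinuousMulEquiv.symm_apply_apply, archLocalOfEmb_archAtEmb]
  -- (b) membership in `Kc`
  have memKc : ∀ {k : (adelicGroupData Fp L c 3 H).Adelic}, k ∈ proj.ker.map toA →
      ∃ a : arch Fp L c 3 H, archAt Fp L c 3 H w₁ (hfix w₁.1) hc a = 1 ∧ toA a = k := by
    intro k hk
    obtain ⟨a, ha, rfl⟩ := Subgroup.mem_map.1 hk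
    refine ⟨a, ?_, rfl⟩
    have ha' : a ∈ (archAt Fp L c 3 H w₁ (hfix w₁.1) hc).ker := by
      rw [← ker_archProjU21Emb Fp L c H ι hι T hT' (hfix _) hc]; exact ha
    exact MonoidHom.mem_ker.1 ha'
  have mkKc : ∀ {a : arch Fp L c 3 H}, archAt Fp L c 3 H w₁ (hfix w₁.1) hc a = 1 → toA a ∈ proj.ker.map toA := by
    intro a ha
    refine Subgroup.mem_map.2 ⟨a, ?_, rfl⟩
    rw [ker_archProjU21Emb Fp L c H ι hι T hT' (hfix _) hc]
    exact MonoidHom.mem_ker.2 ha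
  -- (c) decomposition of an archimedean element
  have decomp : ∀ a : arch Fp L c 3 H, ∃ a' : arch Fp L c 3 H,
      archAt Fp L c 3 H w₁ (hfix w₁.1) hc a' = 1 ∧ toA a = ιinf (proj a) * toA a' := by
    intro a
    refine ⟨(archSingle Fp L c 3 H hc hfix w₁ (archAt Fp L c 3 H w₁ (hfix w₁.1) hc a))⁻¹ * a, ?_, ?_⟩
    · rw [map_mul, map_inv, archAt_archSingle_self, inv_mul_cancel]
    · rw [key a, ← map_mul, mul_inv_cancel_left]
  refine ⟨?_, ?_, ?_, ?_⟩
  -- (1) `ιinf` commutes with `Kc`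
  · intro u k hk
    rw [hKc] at hk
    obtain ⟨a, ha, rfl⟩ := memKc hk
    have hmem : toA a ∈ awayFrom Fp L c 3 H hc hfix w₁ := (archToAdelic_mem_awayFrom_iff Fp L c 3 H hc hfix w₁ a).2 ha
    exact (commute_archSectionU21Emb_of_mem_awayFrom Fp L c hc hfix ι hι H T hT' u hmem).eq.symm
  -- (2) `ιinf` commutes with the finite-adelic points
  · intro u g
    exact (commute_archSectionU21Emb_of_mem_awayFrom Fp L c hc hfix ι hι H T hT' u
      (finAdelicToAdelic_mem_awayFrom Fp L c 3 H hc hfix w₁ g)).eq.symm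
  -- (3) `Kc` commutes with the finite-adelic points
  · intro k hk g
    rw [hKc] at hk
    obtain ⟨a, -, rfl⟩ := memKc hk
    exact (commute_archToAdelic_finAdelicToAdelic Fp L c 3 H a g).eq
  -- (4) product decomposition
  · intro x
    obtain ⟨a', ha', hdec⟩ := decomp (archPart Fp L c 3 H x)
    refine ⟨proj (archPart Fp L c 3 H x), toA a', finPart Fp L c 3 H x, ?_, ?_⟩
    · rw [hKc]; exact mkKc ha'
    · rw [hιinf, ← hdec]
      exact (archToAdelic_mul_finAdelicToAdelic Fp L c 3 H x).symm

/-! ## §2 The same four clauses for the `U(2,1)_{Fin 2 ⊕ Fin 1}`-framed section `cmArchSectionUForm` (F1b's binders VERBATIM) -/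

/-- F1b's `hcomm₁` at the CM datum: `cmArchSectionUForm h` commutes with `cmCompactFactor`. [cite: BorelJacquet1979, §4.1] -/
theorem cmArchSectionUForm_mul_eq_mul_of_mem_cmCompactFactor (h : (uFormGroup (Fin 2) (Fin 1)).carrier)
    (k : (adelicGroupData (↥(maximalRealSubfield L)) L (IsCMField.complexConj L) 3 H).Adelic) (hk : k ∈ cmCompactFactor L ι H T hT) :
    cmArchSectionUForm L ι H T hT h * k = k * cmArchSectionUForm L ι H T hT h := by
  rw [cmArchSectionUForm_apply]
  exact (cm_threeFactor L ι H T hT).1 _ k hk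

/-- F1b's `hcomm₂` at the CM datum: `cmArchSectionUForm h` commutes with the finite-adelic points. [cite: BorelJacquet1979, §4.1] -/
theorem cmArchSectionUForm_mul_finAdelicToAdelic (h : (uFormGroup (Fin 2) (Fin 1)).carrier)
    (b : finAdelic (↥(maximalRealSubfield L)) L (IsCMField.complexConj L) 3 H) :
    cmArchSectionUForm L ι H T hT h * finAdelicToAdelic (↥(maximalRealSubfield L)) L (IsCMField.complexConj L) 3 H b =
      finAdelicToAdelic (↥(maximalRealSubfield L)) L (IsCMField.complexConj L) 3 H b * cmArchSectionUForm L ι H T hT h := by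
  rw [cmArchSectionUForm_apply]
  exact (cm_threeFactor L ι H T hT).2.1 _ b

/-- F1b's `hcomm₃` at the CM datum: `cmCompactFactor` commutes with the finite-adelic points. [cite: BorelJacquet1979, §4.1] -/
theorem mul_finAdelicToAdelic_of_mem_cmCompactFactor
    (k : (adelicGroupData (↥(maximalRealSubfield L)) L (IsCMField.complexConj L) 3 H).Adelic) (hk : k ∈ cmCompactFactor L ι H T hT)
    (b : finAdelic (↥(maximalRealSubfield L)) L (IsCMField.complexConj L) 3 H) :
    k * finAdelicToAdelic (↥(maximalRealSubfield L)) L (IsCMField.complexConj L) 3 H b =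
      finAdelicToAdelic (↥(maximalRealSubfield L)) L (IsCMField.complexConj L) 3 H b * k :=
  (cm_threeFactor L ι H T hT).2.2.1 k hk b

/-- F1b's `hgen` at the CM datum: every adelic point is `cmArchSectionUForm h · k · (1, b)` with `k ∈ cmCompactFactor`.
[cite: BorelJacquet1979, §4.1] [cite: PlatonovRapinchuk1994, §5.1] -/
theorem exists_eq_cmArchSectionUForm_mul_mul (g : (adelicGroupData (↥(maximalRealSubfield L)) L (IsCMField.complexConj L) 3 H).Adelic) :
    ∃ (h : (uFormGroup (Fin 2) (Fin 1)).carrier)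
      (k : (adelicGroupData (↥(maximalRealSubfield L)) L (IsCMField.complexConj L) 3 H).Adelic)
      (b : finAdelic (↥(maximalRealSubfield L)) L (IsCMField.complexConj L) 3 H),
      k ∈ cmCompactFactor L ι H T hT ∧
        g = cmArchSectionUForm L ι H T hT h * k * finAdelicToAdelic (↥(maximalRealSubfield L)) L (IsCMField.complexConj L) 3 H b := by
  obtain ⟨u, k, b, hk, hg⟩ := (cm_threeFactor L ι H T hT).2.2.2 g
  exact ⟨u21FrameEquivFin1 u, k, b, hk, by rwa [cmArchSectionUForm_apply_u21FrameEquivFin1]⟩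

end Summit.HodgeConjecture.HodgeConjecture.Cruxes.H413.F0P3CMThreeFactor

end
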